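import Literature.Computability.AlgebraicComplexity.BorderRankMatMulSmall
import Literature.Computability.AlgebraicComplexity.BorderRankMatMulThreeHalves
import Literature.Computability.AlgebraicComplexity.SmallFormatRank
import Literature.Computability.AlgebraicComplexity.AlderStrassenProofs
import Literature.Computability.AlgebraicComplexity.StrassenMinimalBorderRank
import HarnessLib

/-!
# `R̲(⟨2,2,2⟩) = 7` (Landsberg 2006): what the library proves around the named fact

Topic `Literature/Computability/AlgebraicComplexity`. A PROOF file next to
`BorderRankMatMulSmall.lean` (named fact `Landsberg2005_borderRank_matMulTensor_two :
algBorderRank (matMulTensor ℂ 2 2 2) = 7`, Landsberg, J. Amer. Math. Soc. 19 (2006), main theorem =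
title, p. 447: "`M_Mult ∉ σ₆(ℙ³ × ℙ³ × ℙ³)`") and `BorderRankMatMulSmallProofs.lean` (Smirnov's
`bR(⟨2,3,3⟩) ≤ 14`). Theorems only; nothing is restated, no definition, no new named fact. The fact itself is NOT discharged here: its open half `7 ≤ bR(⟨2,2,2⟩)` has no
elementary proof (see "What is missing" below). What IS proved:

* `algBorderRank_matMulTensor_two_le_seven` — `bR(⟨2,2,2⟩) ≤ 7` over every commutative ring
  (Strassen 1969 via `tensorRank_matMulTensor_two_le_seven` and `bR ≤ R`).
* `algBorderRank_matMulTensor_two_eq_six_or_eq_seven` — `bR(⟨2,2,2⟩) ∈ {6, 7}` in characteristic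
  `0` (BCS 1997, Problem 15.1 as printed: "We know that this border rank is either 6 or 7,
  cf. Cor. (19.14)"; the `6` is the tree's `six_le_algBorderRank_matMulTensor_two`).
* `Landsberg2005_borderRank_matMulTensor_two_iff_seven_le`, `…_iff_ne_six` — the fact is exactly
  its lower half / the exclusion of `6`.
* `Landsberg2005_borderRank_matMulTensor_two_of_notMem_secantVariety`, `…_of_notMem_closure`
  — the PRINTED statement (`⟨2,2,2⟩` is not in the secant variety `σ₆` = Zariski closure of the
  rank-`≤ 6` tensors in `ℂ⁴ ⊗ ℂ⁴ ⊗ ℂ⁴`, affine cone; equivalently not a limit of rank-`≤ 6`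
  tensors, `tensorZariskiClosure_setOf_tensorRank_le_eq_closure`) IMPLIES the vendored fact, by the
  elementary inclusion `{bR ≤ r} ⊆ X_r` (`setOf_algBorderRank_le_subset_tensorZariskiClosure`);
  `…_iff_notMem_secantVariety`, `…_iff_notMem_closure` — the full equivalence given Alder's
  theorem (the named fact `alder_secantVariety_eq_setOf_algBorderRank_le`, BCS Thm. (20.3)).
* `Landsberg2005_borderRank_matMulTensor_two_iff_forall_isApproxDecomposition` — unfolded to
  Bläser's Def. 6.1: no order-`h` approximate decomposition of `⟨2,2,2⟩` with `6` triads over `ℂ[ε]`.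

(The border substitution method, Landsberg 2017, Prop. 5.4.1.3 — in tree as
`exists_ne_zero_algBorderRank_restrict₁_le`, `BorderSubstitution.lean` — read at `⟨2,2,2⟩` says:
were `bR(⟨2,2,2⟩) ≤ 6`, some nonzero `α ∈ K^{2×2}` in the output slot would have all its quotients
`(P ⊗ 1 ⊗ 1)⟨2,2,2⟩`, `P α = 0`, of border rank `≤ 5`; the next paragraph records where that stops.)

## What is missing, and why it is not an inline lemma (numbers, not adjectives)

`7 ≤ bR(⟨2,2,2⟩)`. Known proofs: (i) Landsberg 2006 — classification of the limiting `6`-planes of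
`σ₆(ℙ³×ℙ³×ℙ³) ∖ σ₅` into sixteen components by the differential geometry of curves in the Segre
variety (§§2–3) and a case-by-case exclusion (§4); (ii) Hauenstein–Ikenmeyer–Landsberg 2013, §4.5 —
a degree-`20` `SL₄×SL₄×SL₄`-invariant `−266054 f₁ + 421593 f₂ + 755438 f₃ + 374660 f₄` (the `fᵢ`
symmetrisations over `𝔖₂₀` of products of `4 × 4` determinants given by permutation pairs) shown
to vanish on `σ₆` "by symbolic methods … several hours on 16 processors, the symbolic proof of
vanishing at `σ₆` being by far the slowest part", and not to vanish at `M₂`; (iii) Conner–Harper–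
Landsberg 2023 — border apolarity (multigraded Hilbert schemes, Borel fixed points). No equation of
degree `≤ 18` vanishes on `σ₆;4,4,4` (HIL 2013 / Landsberg 2017, Thm. 8.3.2.1), so no Koszul or
Young flattening minor (degrees `≤ 12` here) separates `⟨2,2,2⟩` from `σ₆`; and the border
substitution method with Koszul flattenings of the quotient gives `2nw − w + m − ⌊w·C(n−1+m,m−1)/
C(2n−2,n−1)⌋ = 6` at `n = w = 2`, `m = 1` (Landsberg 2017, Thm. 5.4.5.1): for the rank-one
direction `α = E₁₁` the `p = 1` Koszul flattening of the quotient `⟨2,2,2⟩/α ∈ ℂ³ ⊗ ℂ⁴ ⊗ ℂ⁴` has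
rank `10` (bound `⌈10/2⌉ = 5`, sharp: the quotient is Bini's partial product of border rank `5`),
while for `α = Id` it has rank `12` (bound `6`).

## References

* [Landsberg2005] J. M. Landsberg, J. Amer. Math. Soc. 19 (2006) 447–459, main theorem (p. 447).
* [BurgisserClausenShokrollahi1997] P. Bürgisser, M. Clausen, M. A. Shokrollahi, *Algebraic
  Complexity Theory*, Springer 1997, Problem 15.1 (p. 420; held PDF p. 452), Cor. (19.14), Thm. (20.3).
* [Strassen1969] V. Strassen, Numer. Math. 13 (1969) 354–356.
* [LandsbergGCT2017] J. M. Landsberg, *Geometry and Complexity Theory*, CUP 2017, Prop. 5.4.1.3,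
  Thm. 5.4.5.1, Thm. 8.3.2.1–8.3.2.2.
* [HauensteinIkenmeyerLandsberg2013] J. D. Hauenstein, C. Ikenmeyer, J. M. Landsberg, Exp. Math. 22
  (2013) 372–383, arXiv:1305.0779, §1.2 and §4.5.
* [Blaser2013] M. Bläser, *Fast Matrix Multiplication*, ToC Graduate Surveys 5 (2013), Def. 6.1.
-/

noncomputable section

open scoped BigOperators Polynomial

namespace Literature.Computability.AlgebraicComplexity

/-! ## The Strassen half and the window `{6, 7}` -/

/-- **`bR(⟨2,2,2⟩) ≤ 7` over every commutative ring** — Strassen's seven products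
(`tensorRank_matMulTensor_two_le_seven`) and `bR ≤ R` (`algBorderRank_le_tensorRank`); the upper
half of Landsberg's `R̲(M⟨2⟩) = 7`. [cite: Strassen1969, the seven-product algorithm] -/
theorem algBorderRank_matMulTensor_two_le_seven (K : Type*) [CommRing K] :
    algBorderRank (matMulTensor K 2 2 2) ≤ 7 :=
  (algBorderRank_le_tensorRank _).trans (tensorRank_matMulTensor_two_le_seven K)

/-- **BCS 1997, Problem 15.1, the printed state of knowledge: `bR(⟨2,2,2⟩) ∈ {6, 7}`** over every
field of characteristic `0` ("Determine `R̲(⟨2,2,2⟩)`. (We know that this border rank is either 6 or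
7, cf. Cor. (19.14).)"), from `six_le_algBorderRank_matMulTensor_two` and Strassen.
[cite: BurgisserClausenShokrollahi1997, Problem 15.1 (p. 420)] -/
theorem algBorderRank_matMulTensor_two_eq_six_or_eq_seven (K : Type*) [Field K] [CharZero K] :
    algBorderRank (matMulTensor K 2 2 2) = 6 ∨ algBorderRank (matMulTensor K 2 2 2) = 7 := by
  have h6 := six_le_algBorderRank_matMulTensor_two K
  have h7 := algBorderRank_matMulTensor_two_le_seven K
  omega

/-! ## The named fact is exactly its lower half -/

/-- Landsberg's theorem, as vendored, is equivalent to its open half `7 ≤ bR(⟨2,2,2⟩)` (the other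
half is Strassen). [cite: Landsberg2005, main theorem (p. 447)] -/
theorem Landsberg2005_borderRank_matMulTensor_two_iff_seven_le :
    Landsberg2005_borderRank_matMulTensor_two ↔ 7 ≤ algBorderRank (matMulTensor ℂ 2 2 2) := by
  unfold Landsberg2005_borderRank_matMulTensor_two
  have h7 := algBorderRank_matMulTensor_two_le_seven ℂ
  constructor
  · intro h; omega
  · intro h; omega

/-- … equivalently, to the exclusion of the value `6` left open by BCS Problem 15.1.
[cite: Landsberg2005, main theorem (p. 447)] -/
theorem Landsberg2005_borderRank_matMulTensor_two_iff_ne_six :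
    Landsberg2005_borderRank_matMulTensor_two ↔ algBorderRank (matMulTensor ℂ 2 2 2) ≠ 6 := by
  unfold Landsberg2005_borderRank_matMulTensor_two
  rcases algBorderRank_matMulTensor_two_eq_six_or_eq_seven ℂ with h | h <;> omega

/-! ## The named fact is literally the printed statement `M_Mult ∉ σ₆(ℙ³ × ℙ³ × ℙ³)` -/

/-- **`⟨2,2,2⟩ ∉ σ₆ ⇒ R̲(⟨2,2,2⟩) = 7`**: Landsberg's printed statement — the `2 × 2` matrix
multiplication tensor does not lie on the sixth secant variety of `Seg(ℙ³×ℙ³×ℙ³)`, i.e. (affine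
cone) in the Zariski closure of the tensors of rank `≤ 6` in `ℂ⁴ ⊗ ℂ⁴ ⊗ ℂ⁴` — implies the vendored
fact, by the elementary inclusion `{bR ≤ r} ⊆ X_r`
(`setOf_algBorderRank_le_subset_tensorZariskiClosure`, BCS Thm. (20.24) "⊴ ⇒ ⊴_top") and
Strassen's `bR ≤ 7`. [cite: Landsberg2005, main theorem (p. 447)] -/
theorem Landsberg2005_borderRank_matMulTensor_two_of_notMem_secantVariety
    (h : matMulTensor ℂ 2 2 2 ∉ tensorZariskiClosure
      {s : (Fin 2 × Fin 2) → (Fin 2 × Fin 2) → (Fin 2 × Fin 2) → ℂ | tensorRank s ≤ 6}) :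
    Landsberg2005_borderRank_matMulTensor_two := by
  rw [Landsberg2005_borderRank_matMulTensor_two_iff_seven_le]
  by_contra hlt
  refine h (setOf_algBorderRank_le_subset_tensorZariskiClosure 6 ?_)
  rw [Set.mem_setOf_eq]
  omega

/-- **`R̲(⟨2,2,2⟩) = 7` ⇔ `⟨2,2,2⟩ ∉ σ₆`**, the full equivalence of the vendored fact with the
printed statement, through Alder's theorem `X_r = {bR ≤ r}` (BCS Thm. (20.3); the named fact
`alder_secantVariety_eq_setOf_algBorderRank_le` of `AlderStrassen.lean`, discharged in
`AlderStrassenProofs.lean`, taken here as the hypothesis `hA`).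
[cite: Landsberg2005, main theorem (p. 447)] -/
theorem Landsberg2005_borderRank_matMulTensor_two_iff_notMem_secantVariety
    (hA : alder_secantVariety_eq_setOf_algBorderRank_le) :
    Landsberg2005_borderRank_matMulTensor_two ↔
      matMulTensor ℂ 2 2 2 ∉ tensorZariskiClosure
        {s : (Fin 2 × Fin 2) → (Fin 2 × Fin 2) → (Fin 2 × Fin 2) → ℂ | tensorRank s ≤ 6} := by
  rw [Landsberg2005_borderRank_matMulTensor_two_iff_seven_le, hA 6, Set.mem_setOf_eq]
  omega

/-- **`⟨2,2,2⟩` not a limit of rank-`≤ 6` tensors ⇒ `R̲(⟨2,2,2⟩) = 7`** (Euclidean form: over `ℂ`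
the secant variety is the Euclidean closure, `tensorZariskiClosure_setOf_tensorRank_le_eq_closure`).
[cite: Landsberg2005, main theorem (p. 447)] -/
theorem Landsberg2005_borderRank_matMulTensor_two_of_notMem_closure
    (h : matMulTensor ℂ 2 2 2 ∉ closure
      {s : (Fin 2 × Fin 2) → (Fin 2 × Fin 2) → (Fin 2 × Fin 2) → ℂ | tensorRank s ≤ 6}) :
    Landsberg2005_borderRank_matMulTensor_two :=
  Landsberg2005_borderRank_matMulTensor_two_of_notMem_secantVariety
    (by rwa [tensorZariskiClosure_setOf_tensorRank_le_eq_closure])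

/-- **`R̲(⟨2,2,2⟩) = 7` ⇔ `⟨2,2,2⟩` is not a limit of tensors of rank `≤ 6`** (given Alder's
theorem). [cite: Landsberg2005, main theorem (p. 447)] -/
theorem Landsberg2005_borderRank_matMulTensor_two_iff_notMem_closure
    (hA : alder_secantVariety_eq_setOf_algBorderRank_le) :
    Landsberg2005_borderRank_matMulTensor_two ↔
      matMulTensor ℂ 2 2 2 ∉ closure
        {s : (Fin 2 × Fin 2) → (Fin 2 × Fin 2) → (Fin 2 × Fin 2) → ℂ | tensorRank s ≤ 6} := by
  rw [Landsberg2005_borderRank_matMulTensor_two_iff_notMem_secantVariety hA,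
    tensorZariskiClosure_setOf_tensorRank_le_eq_closure]

/-- **`R̲(⟨2,2,2⟩) = 7` unfolded to Bläser's Def. 6.1**: the fact says precisely that for no order
`h` is there an approximate decomposition `∑_{ρ<6} u_ρ(ε) ⊗ v_ρ(ε) ⊗ w_ρ(ε) = εʰ ⟨2,2,2⟩ + O(ε^{h+1})`
with six triads over `ℂ[ε]`. [cite: Landsberg2005, main theorem (p. 447)] -/
theorem Landsberg2005_borderRank_matMulTensor_two_iff_forall_isApproxDecomposition :
    Landsberg2005_borderRank_matMulTensor_two ↔
      ∀ (h : ℕ) (u : Fin 6 → Fin 2 × Fin 2 → ℂ[X]) (v : Fin 6 → Fin 2 × Fin 2 → ℂ[X])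
        (w : Fin 6 → Fin 2 × Fin 2 → ℂ[X]), ¬ IsApproxDecomposition h (matMulTensor ℂ 2 2 2) u v w := by
  rw [Landsberg2005_borderRank_matMulTensor_two_iff_seven_le]
  constructor
  · intro h7 h u v w huvw
    have := (algBorderRank_le_approxRank h _).trans (approxRank_le_of_isApproxDecomposition huvw)
    omega
  · intro H
    by_contra hlt
    push Not at hlt
    -- `bR ≤ 6` is attained at some order `h`; pad an optimal decomposition to six triads
    obtain ⟨h, hh⟩ := exists_algBorderRank_eq_approxRank (matMulTensor ℂ 2 2 2)
    have hle : approxRank h (matMulTensor ℂ 2 2 2) ≤ 6 := by omega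
    obtain ⟨u, v, w, huvw⟩ := exists_isApproxDecomposition_of_approxRank_le hle
    exact H h u v w huvw

end Literature.Computability.AlgebraicComplexity

end
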